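import Mathlib.Analysis.Normed.Affine.MazurUlam
import Literature.Geometry.DiscreteGeometry.LayerStackings
import Literature.Geometry.DiscreteGeometry.LayerShellPatterns
import Literature.MathematicalPhysics.StatisticalMechanics.BarlowStacking
import Summits.AtomisticToContinuum.Crystallization.Theorems.SlackRigidity.Negative.WitnessBasics
import Summits.AtomisticToContinuum.Crystallization.Theorems.ShellsToBarlowChart.Negative.Calibration
import HarnessLib

/-!
# Line `c-layer-witness-strictness` (crux `SlackRigidity`, stmt-AtomisticToContinuum-11960):
# layering at the ideal ratio

Stub `stub_layeringIdeal` of the line skeleton: at the ideal ratio `h² = 2a²/3`, a set `Y ∋ 0`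
in `ℝ³` each of whose recentred `6a/5`-stars `((· - y) '' Y) ∩ B̄(0, 6a/5)` is a linearly rotated
copy of the `6a/5`-star of a Barlow stacking `barlowStacking a h s` (`s` Hägg) is ONE linearly
rotated Barlow stacking, `Y = A '' barlowStacking a h s`.

Proof (Hales, *Dense Sphere Packings* §1.3, in the tree as `HalesDSP_layerPackings_holds`).

* SCALING (`smul_barlowPos`, `smul_mem_barlowStacking_iff` of
  `Theorems/ShellsToBarlowChart/Negative/Calibration.lean`): `t • barlowPos a h s = barlowPos
  (t a) (t h) s`; with `c = 2/a` and `h = a√(2/3)`, `c • barlowStacking a h s` is Hales's stacking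
  `barlowStacking 2 (2√(2/3)) s`.
* `V := c • Y` is a packing of unit balls: two points of `Y` at distance `< a` differ by `B p`
  with `p` a point of an ideal stacking of norm `< a`, so `p = 0`
  (`le_dist_of_mem_barlowStacking_ideal`); and every kissing shell of `V` is
  `B '' kissingShell (barlowStacking 2 (2√(2/3)) s_y) 0`, an FCC or HCP pattern
  (`hasFccOrHcpShells_barlowStacking'`, `IsArrangedIn` being invariant under the linear
  isometry `B`).
* `HalesDSP_layerPackings_holds` gives `V = g '' barlowStacking 2 (2√(2/3)) s` for an isometry
  `g` of `ℝ³`.  RE-ROOTING (`barlowStacking_eq_image_shift`): `0 = g x₀` with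
  `x₀ = barlowPos s k₀ i₀ j₀`, and `barlowStacking s = x₀ + barlowStacking (s ∘ (· + k₀))`
  (labels `L (n + k₀) − L k₀`, `haggLabel_shift`), so `V = g' '' barlowStacking 2 (2√(2/3)) s'`
  with `g' = g ∘ (· + x₀)` fixing `0`, hence linear (Mazur–Ulam,
  `IsometryEquiv.toRealLinearIsometryEquivOfMapZero`).  Unscale.

All `[folklore]` given the cited tree theorems.
-/

noncomputable section

namespace Summit.AtomisticToContinuum.Crystallization.Theorems.CLayerWitnessLayeringIdeal

open Literature.Geometry.DiscreteGeometry Literature.MathematicalPhysics.StatisticalMechanics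
open Summit.AtomisticToContinuum.Crystallization.Theorems.SlackRigidityNegative (E3)
open Summit.AtomisticToContinuum.Crystallization.Theorems.ShellsToBarlowChartNegative
  (smul_mem_barlowStacking_iff)

/-! ## Barlow-stacking algebra: the origin, re-rooting -/

/-- The origin is the point `(0, 0, 0)` of every Barlow stacking. [folklore] -/
@[simp] theorem barlowPos_zero_zero_zero (a h : ℝ) (s : ℤ → ℤ) : barlowPos a h s 0 0 0 = 0 := by
  simp [barlowPos]

/-- The origin belongs to every Barlow stacking. [folklore] -/
theorem zero_mem_barlowStacking (a h : ℝ) (s : ℤ → ℤ) : (0 : E3) ∈ barlowStacking a h s :=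
  ⟨0, 0, 0, (barlowPos_zero_zero_zero a h s).symm⟩

/-- Labels of the re-rooted Hägg sequence `n ↦ s (n + k₀)`: `L' n = L (n + k₀) − L k₀`.
[folklore] -/
theorem haggLabel_shift (s : ℤ → ℤ) (k₀ n : ℤ) :
    haggLabel (fun m => s (m + k₀)) n = haggLabel s (n + k₀) - haggLabel s k₀ := by
  induction n using Int.induction_on with
  | zero => simp
  | succ n ih =>
    rw [haggLabel_succ, ih, show (n : ℤ) + 1 + k₀ = (n + k₀) + 1 by ring, haggLabel_succ]
    ring
  | pred n ih =>
    have h1 := haggLabel_succ (fun m => s (m + k₀)) (-(n : ℤ) - 1)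
    have h2 := haggLabel_succ s (-(n : ℤ) - 1 + k₀)
    rw [sub_add_cancel] at h1
    rw [show -(n : ℤ) - 1 + k₀ + 1 = -(n : ℤ) + k₀ by ring] at h2
    linarith

/-- Re-rooting a Barlow stacking at its point `(k₀, i₀, j₀)`: the point `(n + k₀, i + i₀, j + j₀)`
of `s` is the point `(n, i, j)` of the shifted sequence `s ∘ (· + k₀)` translated by
`barlowPos s k₀ i₀ j₀`. [folklore] -/
theorem barlowPos_shift (a h : ℝ) (s : ℤ → ℤ) (k₀ i₀ j₀ n i j : ℤ) :
    barlowPos a h s (n + k₀) (i + i₀) (j + j₀) =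
      barlowPos a h (fun m => s (m + k₀)) n i j + barlowPos a h s k₀ i₀ j₀ := by
  simp only [barlowPos, haggLabel_shift, Int.cast_add, Int.cast_sub]
  module

/-- **Re-rooting**: a Barlow stacking, seen from any of its points `x₀ = barlowPos s k₀ i₀ j₀`, is
again a Barlow stacking through the origin — that of the shifted Hägg sequence `s ∘ (· + k₀)`,
translated by `x₀`. [folklore] -/
theorem barlowStacking_eq_image_shift (a h : ℝ) (s : ℤ → ℤ) (k₀ i₀ j₀ : ℤ) :
    barlowStacking a h s =
      (fun p => p + barlowPos a h s k₀ i₀ j₀) '' barlowStacking a h (fun m => s (m + k₀)) := by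
  ext x
  simp only [Set.mem_image, mem_barlowStacking_iff]
  constructor
  · rintro ⟨k, i, j, rfl⟩
    refine ⟨_, ⟨k - k₀, i - i₀, j - j₀, rfl⟩, ?_⟩
    rw [← barlowPos_shift, sub_add_cancel, sub_add_cancel, sub_add_cancel]
  · rintro ⟨_, ⟨n, i, j, rfl⟩, rfl⟩
    exact ⟨n + k₀, i + i₀, j + j₀, (barlowPos_shift a h s k₀ i₀ j₀ n i j).symm⟩

/-- The shifted sequence of a Hägg sequence is a Hägg sequence. [folklore] -/
theorem isHaggSeq_shift {s : ℤ → ℤ} (hs : IsHaggSeq s) (k₀ : ℤ) :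
    IsHaggSeq (fun m => s (m + k₀)) := fun m => hs (m + k₀)

/-- Arrangement in a pattern is transported by a linear isometry of the ambient space.
[folklore] -/
theorem isArrangedIn_image (B : E3 →ₗᵢ[ℝ] E3) {T : Set E3} {P : Finset E3}
    (hT : IsArrangedIn T P) : IsArrangedIn (B '' T) P := by
  obtain ⟨A, rfl⟩ := hT
  refine ⟨B.comp A, ?_⟩
  rw [Set.image_image]
  refine Set.image_congr' fun p => ?_
  simp only [LinearIsometry.coe_comp, Function.comp_apply, map_smul]

/-! ## The recentred star of a point of `Y` -/

section Star

variable {a h : ℝ} {Y : Set E3} {y : E3} {s : ℤ → ℤ} {B : E3 →ₗᵢ[ℝ] E3}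

/-- From the star equation at `y`: a point `y + z ∈ Y` with `‖z‖ ≤ 6a/5` is `y + B p` for a
point `p` of the model stacking. [folklore] -/
theorem exists_of_star
    (hstar : ((fun z => z - y) '' Y) ∩ Metric.closedBall 0 (6 * a / 5) =
      B '' (barlowStacking a h s ∩ Metric.closedBall 0 (6 * a / 5)))
    {z : E3} (hz : y + z ∈ Y) (hzn : ‖z‖ ≤ 6 * a / 5) :
    ∃ p ∈ barlowStacking a h s, B p = z := by
  have hmem : z ∈ ((fun z => z - y) '' Y) ∩ Metric.closedBall 0 (6 * a / 5) :=
    ⟨⟨y + z, hz, by simp⟩, by simpa using hzn⟩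
  rw [hstar] at hmem
  obtain ⟨p, ⟨hp, -⟩, rfl⟩ := hmem
  exact ⟨p, hp, rfl⟩

/-- From the star equation at `y`: every point `p` of the model stacking with `‖p‖ ≤ 6a/5` gives
the point `y + B p ∈ Y`. [folklore] -/
theorem add_mem_of_star
    (hstar : ((fun z => z - y) '' Y) ∩ Metric.closedBall 0 (6 * a / 5) =
      B '' (barlowStacking a h s ∩ Metric.closedBall 0 (6 * a / 5)))
    {p : E3} (hp : p ∈ barlowStacking a h s) (hpn : ‖p‖ ≤ 6 * a / 5) :
    y + B p ∈ Y := by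
  have hmem : B p ∈ ((fun z => z - y) '' Y) ∩ Metric.closedBall 0 (6 * a / 5) := by
    rw [hstar]
    exact ⟨p, ⟨hp, by simpa using hpn⟩, rfl⟩
  obtain ⟨⟨y', hy', hy'eq⟩, -⟩ := hmem
  have hy'eq : y' - y = B p := hy'eq
  have : y' = y + B p := by rw [← hy'eq]; abel
  rw [← this]
  exact hy'

end Star

/-! ## The stub -/

/-- **Layering at the ideal ratio `h = a√(2/3)`** (stub `stub_layeringIdeal` of line
`c-layer-witness-strictness`, crux `SlackRigidity`): a set `Y ∋ 0` in `ℝ³` each of whose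
recentred `6a/5`-stars is a linearly rotated `6a/5`-star of a Barlow stacking
`barlowStacking a h s` (`s` Hägg) is one linearly rotated Barlow stacking.  Reduction to Hales,
*Dense Sphere Packings* §1.3 (`HalesDSP_layerPackings_holds`) by scaling `V := (2/a) • Y`
(a packing of unit balls with FCC/HCP kissing shells), re-rooting the resulting isometry at
`0 ∈ Y` and Mazur–Ulam. [folklore] -/
theorem stub_layeringIdeal :
    ∀ (a h : ℝ), 0 < a → 0 < h → h ^ 2 = 2 * a ^ 2 / 3 →
    ∀ Y : Set E3, (0 : E3) ∈ Y →
      (∀ y ∈ Y, ∃ s : ℤ → ℤ, IsHaggSeq s ∧ ∃ B : E3 →ₗᵢ[ℝ] E3,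
        ((fun z => z - y) '' Y) ∩ Metric.closedBall 0 (6 * a / 5) =
          B '' (barlowStacking a h s ∩ Metric.closedBall 0 (6 * a / 5))) →
      ∃ s : ℤ → ℤ, IsHaggSeq s ∧ ∃ A : E3 →ₗᵢ[ℝ] E3, Y = A '' barlowStacking a h s := by
  intro a h ha hh hid Y hY0 hloc
  have hh' : h ^ 2 = 2 / 3 * a ^ 2 := by rw [hid]; ring
  -- the scale `c = 2 / a`
  set c : ℝ := 2 / a with hc_def
  have hc : 0 < c := by positivity
  have hca : c * a = 2 := by rw [hc_def]; field_simp
  have hch : c * h = 2 * Real.sqrt (2 / 3) := by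
    have h1 : h = a * Real.sqrt (2 / 3) := by
      have h2 : (a * Real.sqrt (2 / 3)) ^ 2 = h ^ 2 := by
        rw [mul_pow, Real.sq_sqrt (by norm_num), hid]; ring
      exact (pow_left_inj₀ hh.le (by positivity) two_ne_zero).1 h2.symm
    rw [h1, ← mul_assoc, hca]
  have hcinv2 : c⁻¹ * 2 = a := by rw [← hca, inv_mul_cancel_left₀ hc.ne']
  have hcinvh : c⁻¹ * (2 * Real.sqrt (2 / 3)) = h := by rw [← hch, inv_mul_cancel_left₀ hc.ne']
  -- scaling between the model stacking at spacing `a` and Hales's stacking at spacing `2`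
  have hscale : ∀ (t : ℤ → ℤ) (p : E3), p ∈ barlowStacking a h t →
      c • p ∈ barlowStacking 2 (2 * Real.sqrt (2 / 3)) t := fun t p hp => by
    have h1 := (smul_mem_barlowStacking_iff hc.ne' (a := a) (h := h) (s := t) (x := p)).2 hp
    rwa [hca, hch] at h1
  have hunscale : ∀ (t : ℤ → ℤ) (q : E3), q ∈ barlowStacking 2 (2 * Real.sqrt (2 / 3)) t →
      c⁻¹ • q ∈ barlowStacking a h t := fun t q hq => by
    have h1 := (smul_mem_barlowStacking_iff (inv_ne_zero hc.ne') (a := 2)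
      (h := 2 * Real.sqrt (2 / 3)) (s := t) (x := q)).2 hq
    rwa [hcinv2, hcinvh] at h1
  -- the scaled set
  set V : Set E3 := (fun y : E3 => c • y) '' Y with hV_def
  have hmemV : ∀ z : E3, c • z ∈ V ↔ z ∈ Y := fun z => by
    constructor
    · rintro ⟨y, hy, hyz⟩
      rwa [← smul_right_injective E3 hc.ne' hyz]
    · exact fun hz => ⟨z, hz, rfl⟩
  -- `V` is a packing of unit balls
  have hpack : IsUnitBallPacking V := by
    rintro v ⟨y, hy, rfl⟩ w ⟨y', hy', rfl⟩ hd
    rw [dist_smul₀, Real.norm_of_nonneg hc.le, ← hca] at hd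
    have hd' : dist y y' < a := lt_of_mul_lt_mul_left hd hc.le
    obtain ⟨sy, hsy, B, hstar⟩ := hloc y hy
    have hzY : y + (y' - y) ∈ Y := by simpa using hy'
    have hzn : ‖y' - y‖ < a := by rwa [← dist_eq_norm, dist_comm]
    obtain ⟨p, hp, hpz⟩ := exists_of_star hstar hzY (by linarith)
    have hpn : ‖p‖ < a := by rwa [← B.norm_map, hpz]
    have hp0 : p = 0 := by
      by_contra hne
      have hle := le_dist_of_mem_barlowStacking_ideal hsy ha hh' hp
        (zero_mem_barlowStacking a h sy) hne
      rw [dist_zero_right] at hle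
      linarith
    have h0 : y' - y = 0 := by rw [← hpz, hp0, map_zero]
    rw [sub_eq_zero.1 h0]
  -- every kissing shell of `V` is an FCC or an HCP pattern
  have hshells : HasFccOrHcpShells V := by
    rintro u ⟨y, hy, rfl⟩
    obtain ⟨sy, hsy, B, hstar⟩ := hloc y hy
    have hK : kissingShell V (c • y) =
        B '' kissingShell (barlowStacking 2 (2 * Real.sqrt (2 / 3)) sy) 0 := by
      ext x
      simp only [kissingShell, Set.mem_setOf_eq, Set.mem_image, zero_add]
      constructor
      · rintro ⟨hxV, hxn⟩
        have hz : y + c⁻¹ • x ∈ Y := by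
          rw [← hmemV, smul_add, smul_inv_smul₀ hc.ne']
          exact hxV
        have hzn : ‖c⁻¹ • x‖ = a := by
          rw [norm_smul, norm_inv, Real.norm_of_nonneg hc.le, hxn, hcinv2]
        obtain ⟨p, hp, hpz⟩ := exists_of_star hstar hz (by rw [hzn]; linarith)
        refine ⟨c • p, ⟨hscale sy p hp, ?_⟩, ?_⟩
        · rw [norm_smul, Real.norm_of_nonneg hc.le, ← B.norm_map, hpz, hzn, hca]
        · rw [map_smul, hpz, smul_inv_smul₀ hc.ne']
      · rintro ⟨q, ⟨hq, hqn⟩, rfl⟩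
        have hp : c⁻¹ • q ∈ barlowStacking a h sy := hunscale sy q hq
        have hpn : ‖c⁻¹ • q‖ = a := by
          rw [norm_smul, norm_inv, Real.norm_of_nonneg hc.le, hqn, hcinv2]
        have hmem := add_mem_of_star hstar hp (by rw [hpn]; linarith)
        refine ⟨?_, by rw [B.norm_map, hqn]⟩
        have e : c • y + B q = c • (y + B (c⁻¹ • q)) := by
          rw [map_smul, smul_add, smul_inv_smul₀ hc.ne']
        rw [e, hmemV]
        exact hmem
    rw [hK]
    rcases hasFccOrHcpShells_barlowStacking' hsy 0 (zero_mem_barlowStacking _ _ sy) with hf | hf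
    · exact Or.inl (isArrangedIn_image B hf)
    · exact Or.inr (isArrangedIn_image B hf)
  -- Hales, Dense Sphere Packings §1.3
  obtain ⟨s, hs, g, hVg⟩ := HalesDSP_layerPackings_holds V hpack ⟨_, ⟨0, hY0, rfl⟩⟩ hshells
  -- re-rooting at `0 ∈ V`
  have h0V : (0 : E3) ∈ V := ⟨0, hY0, smul_zero c⟩
  rw [hVg] at h0V
  obtain ⟨x₀, ⟨k₀, i₀, j₀, rfl⟩, hgx₀⟩ := h0V
  set s' : ℤ → ℤ := fun m => s (m + k₀) with hs'_def
  have hs' : IsHaggSeq s' := isHaggSeq_shift hs k₀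
  set g' : E3 ≃ᵢ E3 :=
    (IsometryEquiv.addRight (barlowPos 2 (2 * Real.sqrt (2 / 3)) s k₀ i₀ j₀)).trans g with hg'_def
  have hg'apply : ∀ x, g' x = g (x + barlowPos 2 (2 * Real.sqrt (2 / 3)) s k₀ i₀ j₀) := fun x => by
    simp [hg'_def]
  have hg'0 : g' 0 = 0 := by rw [hg'apply, zero_add, hgx₀]
  set L : E3 ≃ₗᵢ[ℝ] E3 := g'.toRealLinearIsometryEquivOfMapZero hg'0 with hL_def
  have hL : ∀ x, L x = g (x + barlowPos 2 (2 * Real.sqrt (2 / 3)) s k₀ i₀ j₀) := fun x => by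
    rw [hL_def, IsometryEquiv.coe_toRealLinearIsometryEquivOfMapZero, hg'apply]
  have hVL : V = L '' barlowStacking 2 (2 * Real.sqrt (2 / 3)) s' := by
    rw [hVg, barlowStacking_eq_image_shift 2 (2 * Real.sqrt (2 / 3)) s k₀ i₀ j₀, Set.image_image]
    exact Set.image_congr' fun x => (hL x).symm
  -- unscale
  refine ⟨s', hs', L.toLinearIsometry, ?_⟩
  ext y
  rw [← hmemV, hVL]
  simp only [Set.mem_image, LinearIsometryEquiv.coe_toLinearIsometry]
  constructor
  · rintro ⟨q, hq, hqy⟩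
    refine ⟨c⁻¹ • q, hunscale s' q hq, ?_⟩
    rw [map_smul, hqy, inv_smul_smul₀ hc.ne']
  · rintro ⟨p, hp, rfl⟩
    exact ⟨c • p, hscale s' p hp, by rw [map_smul]⟩

end Summit.AtomisticToContinuum.Crystallization.Theorems.CLayerWitnessLayeringIdeal

end
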